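import Mathlib
import Literature.MathematicalPhysics.QuantumFieldTheory.Balaban1983to89.B5ToronMomentum161

/-!
# B5 (1.69)/(1.73)/(1.83) AT A CONSTANT ABELIAN BACKGROUND ("TORON TWINS", third file): the Fourier blocks
# of the twisted `Δ^ω_a` over the cosets `p = p′ + l` are the fibers (1.73) AT THE SHIFTED REAL MOMENTUM `s′ = p′ + nφ`

statement-level skeleton of published theorems with citation tags; proofs where landed; nothing here is a claim
about the Yang–Mills mass gap

Sources.  T. Bałaban, *Propagators and renormalization transformations for lattice gauge theories. I*, Commun.
Math. Phys. **95** (1984) 17–40 [Balaban1984PropagatorsI] ("B5"): (1.30)–(1.34) p. 23, (1.61) p. 28, (1.69)–(1.70)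
pp. 29–30, (1.73)–(1.76) p. 30, (1.83)–(1.84) p. 31.  T. Bałaban, *Propagators for lattice gauge theories in a
background field*, Commun. Math. Phys. **99** (1985) 389–434 [Balaban1985BackgroundPropagators] ("B9"): (3.3) p. 391,
(3.19)–(3.26) pp. 393–395.

## What the papers print (verbatim)

[B5] p. 30 (1.73): «ΔA − ∂Δ⁻¹Q′*(Q′Δ⁻²Q′*)⁻¹Q′Δ⁻¹∂*A + aQ*QA = J»; p. 31: «To investigate better the operator G we
write it in momentum representation: (1.83) … where φ_μ(p′) = 1 + aΣ_{l″}|u(p′+l″)|²|v_μ(p′+l″)|²/Δ(p′+l″) for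
p′ ≠ 0. (1.84)»; p. 23 (1.33): «ω̃(p′) = (Σ_l |u_k(p′+l)|²/Δ²(p′+l))⁻¹ Σ_l (u_k(p′+l)/Δ(p′+l))(∂*A)~(p′+l)».
[B9] p. 395: «⟨A, Δ_aA⟩ = ⟨DA, DA⟩ + ⟨RD*A, RD*A⟩ + ⟨A, Q*aQA⟩ (3.26) … It coincides with Δ_a in (2.19) [of
Propagators II] if U = 1».

## What this module certifies (kernel-checked, 0 `sorry`, 0 `def`)

For the twisted `Δ^ω_a = DeltaATw n M a ω` of `B5ToronMomentum161` (all letters of (1.69)/(1.73) with the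
translation `S_ν` replaced by `ω_νS_ν`), the characters are still eigenvectors of every letter, so `UΔ^ω_aA` at a
fine momentum `p′ + l ↔ pOf (k, q)` is a combination of the `Â(p′ + l′, ·)` OVER THE SAME COSET `q` — the
flat files' fiber structure — with the twisted symbols in place of the flat ones:
* §1 tools: the twisted gradient/divergence symbols in `dft` (`dft_comp_GradOpTw`, `dft_GradOpTw_adjoint`),
  `LapTw = U^*diag(lsymTw)U` (`LapTw_eq`, `dftV_mul_LapTw`), a DUALITY LEMMA `dft_adjoint_of_dft` (a forward coset
  representation `(Xf)^(p′) = c_QΣ_lσ(p′+l)f^(p′+l)` gives the adjoint one `(X^*g)^(p′+l) = c_Q\overline{σ(p′+l)}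
  ĝ(p′)` by unitarity), whence the twisted (1.76)/(1.84) adjoint **`dft_QvOpTw_adjoint`**;
* §2 the three fiber terms for ANY `ω` (`fiber_LapTw_term`, `fiber_QQTw_term`, `dft_PcTTw_apply`,
  `fiber_dPdTw_term`) and **`fiber_DeltaATw`**: `(UΔ^ω_aA)(p′+l, κ) = lsymTw·Â − ssymTw_κ·lsymTw⁻¹·\overline{uTw}·
  XsTw⁻¹·Σ_{l′} uTw·lsymTw⁻¹·Σ_ν \overline{ssymTw_ν}Â(p′+l′,ν) + a·\overline{uTw vTw_κ}·Σ_{l′} uTw vTw_κ Â(p′+l′,κ)`;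
* §3 at a UNIT twist `ω = twistOf φ`: the same with every symbol replaced by the FLAT symbol of (1.31)/(1.61)/(1.33)
  at `s′ = sOf q + n•φ` (**`fiber_DeltaATw_twistOf`**: letters `dSym`, `DeltaXir ∘ shiftr`, `uSym`, `vSym` of
  `B5Prop11Fiber`/`B4Strip`), and — for every coset whose shifted momentum the caller certifies to be centred and
  non-zero (`hs : |s′_μ| ≤ π`, `hs0 : s′ ≠ 0`; the re-centring `s′ ↦ s′ − 2πm`, `l ↦ l + m` is the caller's
  bookkeeping) — **`fiber_DeltaATw_eq_Da`**: the block IS pass 5's `B5Prop11Inverse.Da (balabanFiber n hn a ha s′ hs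
  hs0)`, i.e. the printed fiber (1.73) whose inverse is (1.83) (`B5Prop11Inverse.G_eq_inv_balaban`) with ALL the
  bounds of `B5Prop11Fiber` (`opNorm_G_le : ‖G‖ ≤ γ₀(d,a)`, the weighted ones) available verbatim at `s′`.

HONEST SCOPE / NOT HERE.  (N1) The twisted operator-level packaging (`calDa`/`calG` twins: the block-diagonal
transport over ALL cosets with the per-coset re-centring permutation, `Δ^ω_a·𝒢^ω = 1`, positivity) and the
twisted (1.90) `γ(d,a)·Σ‖A‖² ≤ re⟨A, Δ^ω_aA⟩` (`B5Eq190FlatCoercivityUniform.b05_form_lower` at `s ↦ s′`, via the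
twins of `B5Prop11Plancherel` §5 and `B5Prop11Lower` §5) are NOT in this file: they need the per-coset re-centring
and the degenerate coset (`s′ ≡ 0 (2π)`, present iff `ω^n` is a unit-lattice character) handled as B5's `p′ = 0`.
(N2) Nothing non-abelian; one charged sector; NOT summit progress (rung R3 of `ym3-torus` is YM₃ on T³ — not d = 4,
not a mass gap, not Clay).
-/

open scoped BigOperators Matrix ComplexConjugate ComplexOrder Matrix.Norms.L2Operator
open Finset Complex

namespace Literature.MathematicalPhysics.QuantumFieldTheory.Balaban1983to89.B5ToronDeltaA169

open Literature.MathematicalPhysics.QuantumFieldTheory.Balaban1983to89.B4Strip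
open Literature.MathematicalPhysics.QuantumFieldTheory.Balaban1983to89.B5Prop11Bound
open Literature.MathematicalPhysics.QuantumFieldTheory.Balaban1983to89.B5Prop11Fiber
open Literature.MathematicalPhysics.QuantumFieldTheory.Balaban1983to89.B5Prop11Plancherel
open Literature.MathematicalPhysics.QuantumFieldTheory.Balaban1983to89.B5Prop11Inverse
open Literature.MathematicalPhysics.QuantumFieldTheory.Balaban1983to89.B5Prop11Lower
open Literature.MathematicalPhysics.QuantumFieldTheory.Balaban1983to89.B5Action121
open Literature.MathematicalPhysics.QuantumFieldTheory.Balaban1983to89.B5Block118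
open Literature.MathematicalPhysics.QuantumFieldTheory.Balaban1983to89.B5Constraint130
open Literature.MathematicalPhysics.QuantumFieldTheory.Balaban1983to89.B5Adjoint130
open Literature.MathematicalPhysics.QuantumFieldTheory.Balaban1983to89.B5LaplaceInverse
open Literature.MathematicalPhysics.QuantumFieldTheory.Balaban1983to89.B5Momentum133
open Literature.MathematicalPhysics.QuantumFieldTheory.Balaban1983to89.B5DeltaA169
open Literature.MathematicalPhysics.QuantumFieldTheory.Balaban1983to89.B5ToronOperators118
open Literature.MathematicalPhysics.QuantumFieldTheory.Balaban1983to89.B5ToronMomentum161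

noncomputable section

/-! ## §1 Tools: twisted gradient/divergence symbols, `LapTw` in momentum space, duality for adjoints -/

section Tools

variable {d : ℕ} (N : Fin d → ℕ) [hN : ∀ μ, NeZero (N μ)]

/-- the symbol of the twisted gradient: `(∂^ωf)^_κ(p) = ssymTw_κ(p) f̃(p)` (twin of `B5DeltaA169.dft_comp_GradOp`).
[cite: Balaban1984PropagatorsI, (1.31) p.23; Balaban1985BackgroundPropagators, (3.3) p.391] -/
theorem dft_comp_GradOpTw (c : ℂ) (ω : Fin d → ℂ) (f : Tor N → ℂ) (κ : Fin d) (p : Tor N) :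
    (dft N *ᵥ comp N (GradOpTw N c ω *ᵥ f) κ) p = ssymTw N c ω κ p * (dft N *ᵥ f) p := by
  have h : comp N (GradOpTw N c ω *ᵥ f) κ = sdiffTw N c ω κ *ᵥ f := rfl
  rw [h, Matrix.mulVec_mulVec, dft_mul_sdiffTw, ← Matrix.mulVec_mulVec, Matrix.mulVec_diagonal]

/-- the symbol of the twisted divergence `(∂^ω)^* = (∂^ω)ᴴ`: `((∂^ω)^*A)~(p) = Σ_ν \overline{ssymTw_ν(p)} Â_ν(p)`
(twin of `B5DeltaA169.dft_GradOp_adjoint`). [cite: Balaban1984PropagatorsI, (1.31) p.23; Balaban1985BackgroundPropagators, (3.8) p.392] -/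
theorem dft_GradOpTw_adjoint (c : ℂ) (ω : Fin d → ℂ) (A : Tor N × Fin d → ℂ) (p : Tor N) :
    (dft N *ᵥ ((GradOpTw N c ω)ᴴ *ᵥ A)) p
      = ∑ ν, conj (ssymTw N c ω ν p) * (dft N *ᵥ comp N A ν) p := by
  rw [GradOpTw_conjTranspose_mulVec_eq, divSTw, Matrix.mulVec_sum, Finset.sum_apply]
  refine Finset.sum_congr rfl fun ν _ => ?_
  rw [Matrix.mulVec_mulVec, dft_mul_sdiffTwH, ← Matrix.mulVec_mulVec, Matrix.mulVec_diagonal]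
  rfl

variable (n : ℕ) [NeZero n] (M : Fin d → ℕ) [hM : ∀ μ, NeZero (M μ)]

/-- `Σ_ν(∇^ω_ν)^*∇^ω_ν = U^* diag(lsymTw) U` on vector functions (twin of `B5Prop11Lower.Lap_eq`): the twisted `Δ`
of (1.90) is multiplication by the twisted symbol, componentwise. [cite: Balaban1984PropagatorsI, (1.31) p.23; Balaban1985BackgroundPropagators, (3.23) p.394] -/
theorem LapTw_eq (ω : Fin d → ℂ) :
    LapTw n M ω = star (dftV (fine n M))
      * Matrix.diagonal (fun i : Tor (fine n M) × Fin d => lsymTw (fine n M) (n : ℂ) ω i.1)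
      * dftV (fine n M) := by
  have hUU : dftV (fine n M) * star (dftV (fine n M)) = 1 := dftV_mul_star (fine n M)
  have hν : ∀ ν, (fdiffTw (fine n M) (n : ℂ) ω ν)ᴴ * fdiffTw (fine n M) (n : ℂ) ω ν
      = star (dftV (fine n M))
        * Matrix.diagonal (fun i => conj (fsymTw (fine n M) (n : ℂ) ω ν i) * fsymTw (fine n M) (n : ℂ) ω ν i)
        * dftV (fine n M) := by
    intro ν
    rw [← Matrix.star_eq_conjTranspose, star_fdiffTw_eq, fdiffTw_eq (fine n M) (n : ℂ) ω ν]
    calc star (dftV (fine n M)) * Matrix.diagonal (star (fsymTw (fine n M) (n : ℂ) ω ν))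
          * dftV (fine n M)
          * (star (dftV (fine n M)) * Matrix.diagonal (fsymTw (fine n M) (n : ℂ) ω ν) * dftV (fine n M))
          = star (dftV (fine n M)) * Matrix.diagonal (star (fsymTw (fine n M) (n : ℂ) ω ν))
            * (dftV (fine n M) * star (dftV (fine n M)))
            * Matrix.diagonal (fsymTw (fine n M) (n : ℂ) ω ν) * dftV (fine n M) := by
              simp only [Matrix.mul_assoc]
      _ = star (dftV (fine n M)) * (Matrix.diagonal (star (fsymTw (fine n M) (n : ℂ) ω ν))
            * Matrix.diagonal (fsymTw (fine n M) (n : ℂ) ω ν)) * dftV (fine n M) := by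
              rw [hUU, Matrix.mul_one]
              simp only [Matrix.mul_assoc]
      _ = _ := by
              rw [Matrix.diagonal_mul_diagonal]
              rfl
  rw [LapTw, Finset.sum_congr rfl fun ν _ => hν ν, ← Finset.sum_mul, ← Finset.mul_sum]
  congr 2
  ext i j
  rw [Matrix.sum_apply]
  by_cases h : i = j
  · subst h
    simp only [Matrix.diagonal_apply_eq, lsymTw, fsymTw_eq_ssymTw]
  · simp [Matrix.diagonal_apply_ne _ h]

/-- `U·Σ_ν(∇^ω_ν)^*∇^ω_ν = diag(lsymTw)·U`. [cite: Balaban1984PropagatorsI, (1.31) p.23; Balaban1985BackgroundPropagators, (3.23) p.394] -/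
theorem dftV_mul_LapTw (ω : Fin d → ℂ) :
    dftV (fine n M) * LapTw n M ω
      = Matrix.diagonal (fun i : Tor (fine n M) × Fin d => lsymTw (fine n M) (n : ℂ) ω i.1)
        * dftV (fine n M) := by
  rw [LapTw_eq, ← Matrix.mul_assoc, ← Matrix.mul_assoc, dftV_mul_star, Matrix.one_mul]

/-- **DUALITY**: a forward momentum representation of a scalar operator `X : L²(T_η) → L²(T₁)` over the cosets,
`(Xf)^(p′) = c_Q Σ_l σ(p′+l) f^(p′+l)`, yields the adjoint one, `(X^*g)^(p′+l) = c_Q \overline{σ(p′+l)} ĝ(p′)` — by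
unitarity of the two transforms and `pOf` injective (this is how (1.30)'s `Σ_l u_kλ̃` and `\overline{u_k}ω̃` pair up).
[cite: Balaban1984PropagatorsI, (1.29)-(1.30) p.23] -/
theorem dft_adjoint_of_dft (X : Matrix (Tor M) (Tor (fine n M)) ℂ) (σ : (Fin d → Fin n) → Tor M → ℂ)
    (hX : ∀ (f : Tor (fine n M) → ℂ) (q : Tor M),
      (dft M *ᵥ (X *ᵥ f)) q
        = (cQ n M : ℂ) * ∑ k : Fin d → Fin n, σ k q * (dft (fine n M) *ᵥ f) (pOf n M (k, q)))
    (g : Tor M → ℂ) (k : Fin d → Fin n) (q : Tor M) :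
    (dft (fine n M) *ᵥ (Xᴴ *ᵥ g)) (pOf n M (k, q)) = (cQ n M : ℂ) * conj (σ k q) * (dft M *ᵥ g) q := by
  obtain ⟨v, hv⟩ : ∃ v : Tor (fine n M) → ℂ, v = fun x => conj (dft (fine n M) (pOf n M (k, q)) x) :=
    ⟨_, rfl⟩
  -- (U₁ v)(p″) = δ_{p″, p′+l}
  have hUv : dft (fine n M) *ᵥ v = Pi.single (pOf n M (k, q)) 1 := by
    funext p''
    have h1 := congrFun (congrFun (dft_mul_conjTranspose (fine n M)) p'') (pOf n M (k, q))
    rw [Matrix.mul_apply, Matrix.one_apply] at h1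
    simp only [Matrix.conjTranspose_apply, Complex.star_def] at h1
    simp only [Matrix.mulVec, dotProduct, hv, Pi.single_apply]
    exact h1
  -- (X v)(y) = c_Q σ(p′+l) \overline{F¹_{p′,y}}
  have hin : ∀ q' : Tor M,
      (∑ k' : Fin d → Fin n, σ k' q' * (Pi.single (pOf n M (k, q)) (1 : ℂ) : Tor (fine n M) → ℂ)
          (pOf n M (k', q')))
        = if q' = q then σ k q else 0 := by
    intro q'
    by_cases hq' : q' = q
    · subst hq'
      rw [if_pos rfl, Finset.sum_eq_single k]
      · rw [Pi.single_eq_same, mul_one]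
      · intro k' _ hk'
        rw [Pi.single_apply, if_neg, mul_zero]
        intro h
        exact hk' (congrArg Prod.fst (pOf_injective n M h))
      · intro h
        exact absurd (Finset.mem_univ k) h
    · rw [if_neg hq']
      refine Finset.sum_eq_zero fun k' _ => ?_
      rw [Pi.single_apply, if_neg, mul_zero]
      intro h
      exact hq' (congrArg Prod.snd (pOf_injective n M h))
  have hXv : ∀ y, (X *ᵥ v) y = (cQ n M : ℂ) * σ k q * conj (dft M q y) := by
    intro y
    rw [dft_inversion M (X *ᵥ v) y]
    simp_rw [hX v, hUv, hin]
    rw [Finset.sum_eq_single q]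
    · rw [if_pos rfl]
      ring
    · intro q' _ hq'
      rw [if_neg hq', mul_zero, mul_zero]
    · intro h
      exact absurd (Finset.mem_univ q) h
  -- `(U₁ X^* g)(p′+l) = Σ_y \overline{(Xv)(y)} g(y)`
  have hL : (dft (fine n M) *ᵥ (Xᴴ *ᵥ g)) (pOf n M (k, q)) = ∑ y, conj ((X *ᵥ v) y) * g y := by
    simp only [Matrix.mulVec, dotProduct, Matrix.conjTranspose_apply, Complex.star_def, hv, map_sum,
      map_mul, Complex.conj_conj, Finset.mul_sum, Finset.sum_mul]
    rw [Finset.sum_comm]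
    refine Finset.sum_congr rfl fun y _ => Finset.sum_congr rfl fun x _ => ?_
    ring
  rw [hL]
  simp_rw [hXv, map_mul, Complex.conj_conj, Complex.conj_ofReal]
  have hR : (dft M *ᵥ g) q = ∑ y, dft M q y * g y := rfl
  rw [hR, Finset.mul_sum]
  refine Finset.sum_congr rfl fun y _ => ?_
  ring

/-- `Q^ω_k` acts component by component: its `κ`-component is the scalar operator with kernel
`Q^ω_k((y,κ),(x,κ))`. [cite: Balaban1984PropagatorsI, (1.18) p.20] -/
theorem comp_QvOpTw_mulVec (ω : Fin d → ℂ) (A : Tor (fine n M) × Fin d → ℂ) (κ : Fin d) :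
    comp M (QvOpTw n M ω *ᵥ A) κ
      = (Matrix.of fun (y : Tor M) (x : Tor (fine n M)) => QvOpTw n M ω (y, κ) (x, κ))
          *ᵥ comp (fine n M) A κ := by
  funext y
  simp only [comp, Matrix.mulVec, dotProduct, Matrix.of_apply]
  rw [Fintype.sum_prod_type]
  refine Finset.sum_congr rfl fun x _ => ?_
  rw [Finset.sum_eq_single κ]
  · intro κ' _ hκ'
    have h0 : QvOpTw n M ω (y, κ) (x, κ') = 0 := by
      simp [QvOpTw, hκ']
    rw [h0, zero_mul]
  · intro h
    exact absurd (Finset.mem_univ κ) h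

omit [NeZero n] in
/-- … and so does its conjugate transpose. [cite: Balaban1984PropagatorsI, (1.18) p.20] -/
theorem comp_QvOpTw_adjoint_mulVec (ω : Fin d → ℂ) (B : Tor M × Fin d → ℂ) (κ : Fin d) :
    comp (fine n M) ((QvOpTw n M ω)ᴴ *ᵥ B) κ
      = (Matrix.of fun (y : Tor M) (x : Tor (fine n M)) => QvOpTw n M ω (y, κ) (x, κ))ᴴ
          *ᵥ comp M B κ := by
  funext x
  simp only [comp, Matrix.mulVec, dotProduct, Matrix.conjTranspose_apply, Matrix.of_apply]
  rw [Fintype.sum_prod_type]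
  refine Finset.sum_congr rfl fun y _ => ?_
  rw [Finset.sum_eq_single κ]
  · intro κ' _ hκ'
    have h0 : QvOpTw n M ω (y, κ') (x, κ) = 0 := by
      simp [QvOpTw, Ne.symm hκ']
    rw [h0, star_zero, zero_mul]
  · intro h
    exact absurd (Finset.mem_univ κ) h

/-- **THE TWISTED `Q*_k` IN MOMENTUM SPACE** (twin of `B5Adjoint176.dft_QvOp_adjoint`, the `\overline{u v_μ}` of
(1.76)/(1.84)): `((Q^ω_k)ᴴB)^_κ(p′+l) = c_Q·\overline{uTw(p′+l)vTw_κ(p′+l)}·B̂_κ(p′)` — by DUALITY from the twisted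
(1.61). [cite: Balaban1984PropagatorsI, (1.61) p.28, (1.76) p.30, (1.84) p.31] -/
theorem dft_QvOpTw_adjoint (ω : Fin d → ℂ) (B : Tor M × Fin d → ℂ) (k : Fin d → Fin n) (q : Tor M)
    (κ : Fin d) :
    (dft (fine n M) *ᵥ comp (fine n M) ((QvOpTw n M ω)ᴴ *ᵥ B) κ) (pOf n M (k, q))
      = (cQ n M : ℂ) * conj (uTw n M ω k q * vTw n M ω k q κ) * (dft M *ᵥ comp M B κ) q := by
  rw [comp_QvOpTw_adjoint_mulVec]
  refine dft_adjoint_of_dft n M _ (fun k' q' => uTw n M ω k' q' * vTw n M ω k' q' κ) ?_ (comp M B κ) k q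
  intro f q'
  have h := dft_QvOpTw n M ω (fun i => f i.1) q' κ
  have hc : comp (fine n M) (fun i : Tor (fine n M) × Fin d => f i.1) κ = f := rfl
  rw [comp_QvOpTw_mulVec, hc] at h
  exact h

end Tools

/-! ## §2 The fiber of `Δ^ω_a` at `p′ + l`, for any twist `ω` -/

section Fiber

variable {d : ℕ} (n : ℕ) [NeZero n] (M : Fin d → ℕ) [hM : ∀ μ, NeZero (M μ)] (a : ℝ) (ω : Fin d → ℂ)

/-- the `Δ_ω` term: `(Δ_ωA)^_κ(p′+l) = lsymTw(p′+l) Â_κ(p′+l)`. [cite: Balaban1984PropagatorsI, (1.31) p.23, (1.73) p.30] -/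
theorem fiber_LapTw_term (A : Tor (fine n M) × Fin d → ℂ) (k : Fin d → Fin n) (q : Tor M) (κ : Fin d) :
    (dftV (fine n M) *ᵥ (LapTw n M ω *ᵥ A)) (pOf n M (k, q), κ)
      = lsymTw (fine n M) (n : ℂ) ω (pOf n M (k, q)) * (dftV (fine n M) *ᵥ A) (pOf n M (k, q), κ) := by
  rw [Matrix.mulVec_mulVec, dftV_mul_LapTw, ← Matrix.mulVec_mulVec, Matrix.mulVec_diagonal]

/-- the `aQ*Q` term: `η^{−d}((Q^ω_k)ᴴQ^ω_kA)^_κ(p′+l) = \overline{uTw vTw_κ}(p′+l) Σ_{l′} (uTw vTw_κ)(p′+l′) Â_κ(p′+l′)`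
— the twisted multiplier of (1.84) (`η^{−d}c_Q² = 1`). [cite: Balaban1984PropagatorsI, (1.83)-(1.84) p.31] -/
theorem fiber_QQTw_term (A : Tor (fine n M) × Fin d → ℂ) (k : Fin d → Fin n) (q : Tor M) (κ : Fin d) :
    ((n : ℂ) ^ d) * (dftV (fine n M) *ᵥ ((QvOpTw n M ω)ᴴ *ᵥ (QvOpTw n M ω *ᵥ A))) (pOf n M (k, q), κ)
      = conj (uTw n M ω k q * vTw n M ω k q κ) *
          ∑ k' : Fin d → Fin n, uTw n M ω k' q * vTw n M ω k' q κ
            * (dftV (fine n M) *ᵥ A) (pOf n M (k', q), κ) := by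
  rw [dftV_mulVec_apply, dft_QvOpTw_adjoint, dft_QvOpTw]
  simp only [dftV_mulVec_apply]
  have h : ((n : ℂ) ^ d) * ((cQ n M : ℂ) * conj (uTw n M ω k q * vTw n M ω k q κ) *
      ((cQ n M : ℂ) * ∑ k' : Fin d → Fin n, uTw n M ω k' q * vTw n M ω k' q κ
        * (dft (fine n M) *ᵥ comp (fine n M) A κ) (pOf n M (k', q))))
      = ((n : ℂ) ^ d * (cQ n M : ℂ) ^ 2) * (conj (uTw n M ω k q * vTw n M ω k q κ) *
          ∑ k' : Fin d → Fin n, uTw n M ω k' q * vTw n M ω k' q κ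
            * (dft (fine n M) *ᵥ comp (fine n M) A κ) (pOf n M (k', q))) := by
    ring
  rw [h, npow_mul_cQ_sq, one_mul]

variable (c : ℂ)

/-- the momentum form of the twisted `P` ((1.70)/(3.25); twin of `B5Momentum133.dft_PcT_apply_of_ne`, valid on EVERY
coset thanks to `0⁻¹ = 0`): `(P^ωb)~(p′+l) = \overline{uTw(p′+l)}/lsymTw(p′+l) · XsTw(p′)⁻¹ · Σ_{l′} uTw(p′+l′)/
lsymTw(p′+l′) b̃(p′+l′)`. [cite: Balaban1984PropagatorsI, (1.33)-(1.34) p.23, (1.70) p.30; Balaban1985BackgroundPropagators, (3.25) p.394] -/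
theorem dft_PcTTw_apply (b : Tor (fine n M) → ℂ) (k : Fin d → Fin n) (q : Tor M) :
    (dft (fine n M) *ᵥ (PcTTw n M c ω *ᵥ b)) (pOf n M (k, q))
      = (lsymTw (fine n M) c ω (pOf n M (k, q)))⁻¹ * conj (uTw n M ω k q) * (XsTw n M c ω q)⁻¹
          * ∑ k' : Fin d → Fin n, uTw n M ω k' q
            * ((lsymTw (fine n M) c ω (pOf n M (k', q)))⁻¹ * (dft (fine n M) *ᵥ b) (pOf n M (k', q))) := by
  have hc := cQ_ne_zero n M
  rw [PcTTw_mulVec, dft_LapSinvTw_apply, dft_QsOpTw_adjoint, dft_MinvTw_apply, dft_QsOpTw]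
  simp_rw [dft_LapSinvTw_apply]
  rw [mul_inv]
  have key : (cQ n M : ℂ) * (((cQ n M : ℂ)) ^ 2)⁻¹ * (cQ n M : ℂ) = 1 := by
    field_simp
  linear_combination ((lsymTw (fine n M) c ω (pOf n M (k, q)))⁻¹ * conj (uTw n M ω k q)
    * (XsTw n M c ω q)⁻¹ * ∑ k' : Fin d → Fin n, uTw n M ω k' q
      * ((lsymTw (fine n M) c ω (pOf n M (k', q)))⁻¹ * (dft (fine n M) *ᵥ b) (pOf n M (k', q)))) * key

/-- the `∂P∂*` term: `(∂^ωP^ω(∂^ω)ᴴA)^_κ(p′+l) = ssymTw_κ(p′+l)·(P^ω(∂^ω)ᴴA)~(p′+l)` with `((∂^ω)ᴴA)~ =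
Σ_ν\overline{ssymTw_ν}Â_ν` (twin of `B5DeltaA169.fiber_dPd_term`). [cite: Balaban1984PropagatorsI, (1.70) p.30, (1.73) p.30, (1.83) p.31] -/
theorem fiber_dPdTw_term (A : Tor (fine n M) × Fin d → ℂ) (k : Fin d → Fin n) (q : Tor M) (κ : Fin d) :
    (dftV (fine n M) *ᵥ (GradOpTw (fine n M) c ω *ᵥ (PcTTw n M c ω *ᵥ
        ((GradOpTw (fine n M) c ω)ᴴ *ᵥ A)))) (pOf n M (k, q), κ)
      = ssymTw (fine n M) c ω κ (pOf n M (k, q))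
        * ((lsymTw (fine n M) c ω (pOf n M (k, q)))⁻¹ * conj (uTw n M ω k q) * (XsTw n M c ω q)⁻¹
          * ∑ k' : Fin d → Fin n, uTw n M ω k' q
            * ((lsymTw (fine n M) c ω (pOf n M (k', q)))⁻¹
              * ∑ ν, conj (ssymTw (fine n M) c ω ν (pOf n M (k', q)))
                * (dftV (fine n M) *ᵥ A) (pOf n M (k', q), ν))) := by
  rw [dftV_mulVec_apply, dft_comp_GradOpTw, dft_PcTTw_apply]
  simp_rw [dft_GradOpTw_adjoint, dftV_mulVec_apply]

/-- **THE FIBER OF THE TWISTED `Δ_a` AT `p′ + l`, ANY TWIST `ω`** (twin of `B5DeltaA169.fiber_DeltaA`):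
`(UΔ^ω_aA)(p′+l, κ) = lsymTw·Â_κ(p′+l) − [∂P∂* term] + a·[Q*Q term]`, a combination of the `Â(p′+l′, ·)` over the
SAME coset — the characters are eigenvectors of every twisted letter. [cite: Balaban1984PropagatorsI, (1.73) p.30, (1.83) p.31; Balaban1985BackgroundPropagators, (3.26) p.395] -/
theorem fiber_DeltaATw (A : Tor (fine n M) × Fin d → ℂ) (k : Fin d → Fin n) (q : Tor M) (κ : Fin d) :
    (dftV (fine n M) *ᵥ (DeltaATw n M a ω *ᵥ A)) (pOf n M (k, q), κ)
      = lsymTw (fine n M) (n : ℂ) ω (pOf n M (k, q)) * (dftV (fine n M) *ᵥ A) (pOf n M (k, q), κ)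
        - ssymTw (fine n M) (n : ℂ) ω κ (pOf n M (k, q))
          * ((lsymTw (fine n M) (n : ℂ) ω (pOf n M (k, q)))⁻¹ * conj (uTw n M ω k q)
            * (XsTw n M (n : ℂ) ω q)⁻¹
            * ∑ k' : Fin d → Fin n, uTw n M ω k' q
              * ((lsymTw (fine n M) (n : ℂ) ω (pOf n M (k', q)))⁻¹
                * ∑ ν, conj (ssymTw (fine n M) (n : ℂ) ω ν (pOf n M (k', q)))
                  * (dftV (fine n M) *ᵥ A) (pOf n M (k', q), ν)))
        + (a : ℂ) * (conj (uTw n M ω k q * vTw n M ω k q κ) *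
            ∑ k' : Fin d → Fin n, uTw n M ω k' q * vTw n M ω k' q κ
              * (dftV (fine n M) *ᵥ A) (pOf n M (k', q), κ)) := by
  rw [DeltaATw_mulVec, Matrix.mulVec_add, Matrix.mulVec_sub, Matrix.mulVec_smul, Pi.add_apply,
    Pi.sub_apply, Pi.smul_apply, smul_eq_mul, fiber_LapTw_term, fiber_dPdTw_term, mul_assoc (a : ℂ),
    fiber_QQTw_term]

end Fiber

/-! ## §3 At a unit twist: the fiber is (1.73) at the shifted real momentum `s′ = p′ + nφ` -/

section UnitTwist

variable {d : ℕ} (n : ℕ) [NeZero n] (M : Fin d → ℕ) [hM : ∀ μ, NeZero (M μ)] (a : ℝ) (φ : Fin d → ℝ)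

/-- the twisted normalising sum of (1.33) at a unit twist is the flat one at `s′`:
`XsTw = Σ_l u(s′+l)\overline{u(s′+l)}/Δ(s′+l)²`. [cite: Balaban1984PropagatorsI, (1.33) p.23] -/
theorem XsTw_twistOf (q : Tor M) :
    XsTw n M (n : ℂ) (twistOf φ) q
      = ∑ k : Fin d → Fin n, uSym n k (sOfTw n M φ q) * conj (uSym n k (sOfTw n M φ q))
          * ((((DeltaXir n 0 (shiftr n k (sOfTw n M φ q)) : ℝ) : ℂ))⁻¹) ^ 2 := by
  rw [XsTw]
  simp_rw [uTw_twistOf, lsymTw_pOf_twistOf]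

/-- **THE FIBER OF `Δ^ω_a` AT A UNIT TWIST, IN THE PRINTED LETTERS AT `s′`**: `∂_μ(s′+l) = dSym n l s′ μ`,
`Δ(s′+l) = DeltaXir n 0 (shiftr n l s′)`, `u(s′+l) = uSym n l s′`, `v_μ(s′+l) = vSym n l s′ μ` (`s′ = sOfTw n M φ q`):
the flat fiber (1.73)/(1.83) with `p′ ↦ s′`. [cite: Balaban1984PropagatorsI, (1.73) p.30, (1.83)-(1.84) p.31, (1.33) p.23] -/
theorem fiber_DeltaATw_twistOf (A : Tor (fine n M) × Fin d → ℂ) (k : Fin d → Fin n) (q : Tor M) (κ : Fin d) :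
    (dftV (fine n M) *ᵥ (DeltaATw n M a (twistOf φ) *ᵥ A)) (pOf n M (k, q), κ)
      = ((DeltaXir n 0 (shiftr n k (sOfTw n M φ q)) : ℝ) : ℂ) * (dftV (fine n M) *ᵥ A) (pOf n M (k, q), κ)
        - dSym n k (sOfTw n M φ q) κ
          * ((((DeltaXir n 0 (shiftr n k (sOfTw n M φ q)) : ℝ) : ℂ))⁻¹
            * conj (uSym n k (sOfTw n M φ q))
            * (∑ l : Fin d → Fin n, uSym n l (sOfTw n M φ q) * conj (uSym n l (sOfTw n M φ q))
                * ((((DeltaXir n 0 (shiftr n l (sOfTw n M φ q)) : ℝ) : ℂ))⁻¹) ^ 2)⁻¹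
            * ∑ k' : Fin d → Fin n, uSym n k' (sOfTw n M φ q)
              * ((((DeltaXir n 0 (shiftr n k' (sOfTw n M φ q)) : ℝ) : ℂ))⁻¹
                * ∑ ν, conj (dSym n k' (sOfTw n M φ q) ν)
                  * (dftV (fine n M) *ᵥ A) (pOf n M (k', q), ν)))
        + (a : ℂ) * (conj (uSym n k (sOfTw n M φ q) * vSym n k (sOfTw n M φ q) κ) *
            ∑ k' : Fin d → Fin n, uSym n k' (sOfTw n M φ q) * vSym n k' (sOfTw n M φ q) κ
              * (dftV (fine n M) *ᵥ A) (pOf n M (k', q), κ)) := by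
  rw [fiber_DeltaATw, XsTw_twistOf]
  simp only [ssymTw_pOf_twistOf, lsymTw_pOf_twistOf, uTw_twistOf, vTw_twistOf]

/-- ★★★ **THE BLOCK IS PASS 5's FIBER `Da` AT `s′`**: for a coset whose shifted momentum `s′ = p′ + nφ` the caller
certifies to be centred (`|s′_μ| ≤ π`) and non-zero, the Fourier block of the twisted `Δ^ω_a` IS
`B5Prop11Inverse.Da (balabanFiber n hn a ha s′ hs hs0)` — the printed fiber (1.73), whose inverse is (1.83)
(`G_eq_inv_balaban`) with `‖G‖ ≤ γ₀(d,a)` (`B5Prop11Fiber.opNorm_G_le`) and the weighted bounds at `s′` verbatim.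
(The re-centring of the other cosets, `s′ ↦ s′ − 2πm`, `l ↦ l + m mod n`, is bookkeeping left to the caller.)
[cite: Balaban1984PropagatorsI, (1.73) p.30, (1.83) p.31; Balaban1985BackgroundPropagators, (3.26) p.395] -/
theorem fiber_DeltaATw_eq_Da (hn : 1 ≤ n) (ha : 0 < a) (q : Tor M)
    (hs : ∀ μ, |sOfTw n M φ q μ| ≤ Real.pi) (hs0 : sOfTw n M φ q ≠ 0)
    (A : Tor (fine n M) × Fin d → ℂ) (k : Fin d → Fin n) (κ : Fin d) :
    (dftV (fine n M) *ᵥ (DeltaATw n M a (twistOf φ) *ᵥ A)) (pOf n M (k, q), κ)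
      = (Da (balabanFiber n hn a ha (sOfTw n M φ q) hs hs0) *ᵥ
          fun j => (dftV (fine n M) *ᵥ A) (pOf n M (j.1, q), j.2)) (k, κ) := by
  have hΔ : ∀ l, ((((balabanFiber n hn a ha (sOfTw n M φ q) hs hs0).Δ l) : ℝ) : ℂ)
      = lsymTw (fine n M) (n : ℂ) (twistOf φ) (pOf n M (l, q)) := by
    intro l
    rw [lsymTw_pOf_twistOf]
    rfl
  have he : ∀ μ l, (balabanFiber n hn a ha (sOfTw n M φ q) hs hs0).e μ l
      = ssymTw (fine n M) (n : ℂ) (twistOf φ) μ (pOf n M (l, q)) := by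
    intro μ l
    rw [ssymTw_pOf_twistOf]
    rfl
  have hu : ∀ l, (balabanFiber n hn a ha (sOfTw n M φ q) hs hs0).u l = uTw n M (twistOf φ) l q := by
    intro l
    rw [uTw_twistOf]
    rfl
  have hv : ∀ μ l, (balabanFiber n hn a ha (sOfTw n M φ q) hs hs0).v μ l = vTw n M (twistOf φ) l q μ := by
    intro μ l
    rw [vTw_twistOf]
    rfl
  have hX : (((balabanFiber n hn a ha (sOfTw n M φ q) hs hs0).X : ℝ) : ℂ) = XsTw n M (n : ℂ) (twistOf φ) q := by
    rw [X_cast, XsTw]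
    refine Finset.sum_congr rfl fun l _ => ?_
    rw [hu, hΔ, div_eq_mul_inv, inv_pow]
  have ha' : (balabanFiber n hn a ha (sOfTw n M φ q) hs hs0).a = a := rfl
  rw [fiber_DeltaATw, Da, Matrix.add_mulVec, Matrix.sub_mulVec, Matrix.smul_mulVec, Pi.add_apply,
    Pi.sub_apply, Pi.smul_apply, smul_eq_mul]
  congr 1
  · congr 1
    · -- the `Δ` term
      rw [lapV, Matrix.mulVec_diagonal, hΔ]
    · -- the `∂P∂*` term
      simp only [Matrix.mulVec, dotProduct, dPd_apply, Pproj_apply, Fintype.sum_prod_type, he, hu, hΔ, hX]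
      simp only [Finset.mul_sum]
      refine Finset.sum_congr rfl fun k' _ => Finset.sum_congr rfl fun ν _ => ?_
      rw [div_eq_mul_inv, mul_inv, mul_inv]
      ring
  · -- the `aQ*Q` term
    simp only [Matrix.mulVec, dotProduct, QQ_apply, cv, Fintype.sum_prod_type, hu, hv, ha', ite_mul, zero_mul,
      Finset.sum_ite_eq, Finset.mem_univ, if_true, map_mul, Complex.conj_conj]
    congr 1
    rw [Finset.mul_sum]
    refine Finset.sum_congr rfl fun k' _ => ?_
    ring

end UnitTwist

end

end Literature.MathematicalPhysics.QuantumFieldTheory.Balaban1983to89.B5ToronDeltaA169
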